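import Summits.Ventures.YMGap.FlowData.RectTubeMagneticTwistSandwich
import Summits.Ventures.YMGap.FlowData.RectTubeMagneticTwistFlatness
import HarnessLib

/-!
# Venture YMGap, track Y3 FLOW-DATA — the STRONG-COUPLING LAW of the magnetic-flux energy:
# `|E_mag(β; Ls; S) − β·h_S| ≤ 4β·#S·(e^{4β(3#P+N)} − 1)`, `h_S = ∫ Σ_{p∈S} Re tr U_p dHaar` (theorems only)

HONEST FRAMING: venture file of the cell `pub-ymgap` (QuantumFields programme), track Y3 (FLOW-DATA); assembles the Gibbs–Bogoliubov
sandwich of `RectTubeMagneticTwistSandwich.lean` (`β∫(Σ Re tr U_p)Ω_S² ≤ E_mag ≤ β∫(Σ Re tr U_p)Ω²`) with the vacuum flatness of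
`RectTubeVacuumFlatness.lean` (both vacua are Haar up to `e^{4c} − 1`): the magnetic-flux energy of the FLOW-TABLE's rows equals `β`
times the HAAR expectation `h_S` of `Σ_{p∈S} Re tr U_p` up to an explicit `O(β²)`.  On a one-site torus every plaquette is a
commutator `U V U⁻¹ V⁻¹` with `⟨Re tr⟩_{Haar} = ½` (so `E_mag = (β/2)·#S + O(β²)`); when every twisted plaquette has four distinct
links `h_S = 0` (so `E_mag = O(β²)`) — those two Haar evaluations are NOT done here (`h_S` stays an explicit integral).  ASYMPTOTIC
statement only (the constant is useless at the table's `β ≥ ¼`); finite spatial torus; no number, no row; nothing about `L → ∞`,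
the continuum or a mass gap.

* (twisted-side flatness is `RectTubeMagneticTwistFlatness.lean`);
* **`su2RectMagneticFluxEnergy_sub_haar_le`** (`E_mag − β h_S ≤ 4β #S (e^{4β(#P+N)} − 1)`), **`su2RectMagneticFluxEnergy_sub_haar_ge`**
  (`−4β #S (e^{4β(3#P+N)} − 1) ≤ E_mag − β h_S`), ★ **`abs_su2RectMagneticFluxEnergy_sub_haar_le`** (`β ≥ 0`).

References: G. 't Hooft, Nucl. Phys. B 153 (1979) 141 [cite: tHooft1979Flux]; M. Reed, B. Simon IV (1978) §XIII.12
[cite: ReedSimonIV1978, §XIII.12]; I. Montvay, G. Münster (1994) §3.2.6 [cite: MontvayMunster1994, §3.2.6].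
-/

noncomputable section

open scoped BigOperators ENNReal RealInnerProductSpace
open MeasureTheory Filter Function
open Literature.MathematicalPhysics.QuantumFieldTheory Literature.Analysis.OperatorTheory
open Literature.MathematicalPhysics.QuantumLattice (RectTorusSite fundamentalRep continuous_fundamentalRep
  fundamentalRep_mem_unitaryGroup)
open Literature.Barriers.QuantumFields
open Summit.Ventures.YMGap.Census (RectPlaquette rectPlaquetteHolonomy)

namespace Summit.Ventures.YMGap.FlowData

/-! ### The cell's `SU(2)` object: the strong-coupling law -/

section SU2

variable {k : ℕ}

/-- The twisted-plaquette load `f_S(a) = Σ_{q∈S} Re tr U_q(a)` is continuous and bounded by `2·#S` (`SU(2)`). [folklore] -/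
theorem su2_plaquetteLoad_continuous_and_bound (Ls : Fin k → ℕ) [∀ i, NeZero (Ls i)] (S : Finset (RectPlaquette Ls)) :
    Continuous (fun a : RectSlice Ls (Matrix.specialUnitaryGroup (Fin 2) ℂ) =>
      ∑ q ∈ S, (fundamentalRep (Fin 2) (rectPlaquetteHolonomy a q.1 q.2.1.1 q.2.1.2)).trace.re) ∧
    ∀ a : RectSlice Ls (Matrix.specialUnitaryGroup (Fin 2) ℂ),
      ‖∑ q ∈ S, (fundamentalRep (Fin 2) (rectPlaquetteHolonomy a q.1 q.2.1.1 q.2.1.2)).trace.re‖ ≤ 2 * S.card := by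
  have htr : ∀ g : Matrix.specialUnitaryGroup (Fin 2) ℂ, |(fundamentalRep (Fin 2) g).trace.re| ≤ (2 : ℕ) := fun g =>
    (Complex.abs_re_le_norm _).trans (FiniteTemperature.norm_trace_le_of_mem_unitaryGroup (fundamentalRep_mem_unitaryGroup _))
  constructor
  · refine continuous_finsetSum _ fun q _ => ?_
    exact (Complex.continuous_re.comp (Continuous.matrix_trace (continuous_fundamentalRep (Fin 2)))).comp
      (continuous_rectPlaquetteHolonomy q.1 q.2.1.1 q.2.1.2)
  · intro a
    rw [Real.norm_eq_abs]
    refine (Finset.abs_sum_le_sum_abs _ _).trans ?_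
    refine (Finset.sum_le_sum fun q _ => htr _).trans (le_of_eq ?_)
    rw [Finset.sum_const, nsmul_eq_mul]; push_cast; ring

/-- **Upper strong-coupling bound: `E_mag(β;Ls;S) − β·h_S ≤ 2β·#S·… `** precisely
`≤ β · (2#S) · (e^{4|β|(#P+N)} − 1)` for `β ≥ 0`, `h_S = ∫ Σ_{q∈S} Re tr U_q dHaar`. [cite: tHooft1979Flux] -/
theorem su2RectMagneticFluxEnergy_sub_haar_le {β : ℝ} (hβ : 0 ≤ β) (Ls : Fin k → ℕ) [∀ i, NeZero (Ls i)]
    (S : Finset (RectPlaquette Ls)) :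
    su2RectMagneticFluxEnergy β Ls S -
        β * ∫ a, (∑ q ∈ S, (fundamentalRep (Fin 2) (rectPlaquetteHolonomy a q.1 q.2.1.1 q.2.1.2)).trace.re)
          ∂(rectSliceMeasure (Matrix.specialUnitaryGroup (Fin 2) ℂ) Ls) ≤
      β * ((2 * S.card) * (Real.exp (4 * (|β| * (Fintype.card (RectTorusSite Ls) * Fintype.card {p : Fin k × Fin k // p.1 < p.2} +
        Fintype.card (RectTorusSite Ls × Fin k)))) - 1)) := by
  haveI : SecondCountableTopology (Matrix.specialUnitaryGroup (Fin 2) ℂ) :=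
    Literature.MathematicalPhysics.QuantumLattice.secondCountableTopology_su2
  obtain ⟨Ω, h1, hpos, heig, -⟩ := exists_rectVacuum (J := β / 2) (Ls := Ls) (fundamentalRep (Fin 2))
    (continuous_fundamentalRep (Fin 2)) fundamentalRep_mem_unitaryGroup su2MinusOne_mem_center
  have hΩ : ∀ᵐ a ∂(rectSliceMeasure (Matrix.specialUnitaryGroup (Fin 2) ℂ) Ls), 0 ≤ Ω a := hpos.mono fun a ha => ha.le
  have hup := su2RectMagneticFluxEnergy_le hβ Ls S h1 heig
  obtain ⟨hfc, hfb⟩ := su2_plaquetteLoad_continuous_and_bound Ls S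
  have hflat := su2_rectTube_abs_vacuum_expectation_sub_haar_le β Ls h1 hΩ heig hfc.stronglyMeasurable hfb
  have hflat' := (abs_le.1 hflat).2
  nlinarith [hup, hflat', hβ]

/-- **Lower strong-coupling bound: `−β·(2#S)·(e^{4|β|(3#P+N)} − 1) ≤ E_mag(β;Ls;S) − β·h_S`** for `β ≥ 0` (flatness of the
TWISTED vacuum). [cite: tHooft1979Flux] -/
theorem su2RectMagneticFluxEnergy_sub_haar_ge {β : ℝ} (hβ : 0 ≤ β) (Ls : Fin k → ℕ) [∀ i, NeZero (Ls i)]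
    (S : Finset (RectPlaquette Ls)) :
    -(β * ((2 * S.card) * (Real.exp (4 * (|β| * (3 * (Fintype.card (RectTorusSite Ls) * Fintype.card {p : Fin k × Fin k // p.1 < p.2}) +
        Fintype.card (RectTorusSite Ls × Fin k)))) - 1))) ≤
      su2RectMagneticFluxEnergy β Ls S -
        β * ∫ a, (∑ q ∈ S, (fundamentalRep (Fin 2) (rectPlaquetteHolonomy a q.1 q.2.1.1 q.2.1.2)).trace.re)
          ∂(rectSliceMeasure (Matrix.specialUnitaryGroup (Fin 2) ℂ) Ls) := by
  haveI : SecondCountableTopology (Matrix.specialUnitaryGroup (Fin 2) ℂ) :=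
    Literature.MathematicalPhysics.QuantumLattice.secondCountableTopology_su2
  obtain ⟨Ω, h1, hpos, heig, -⟩ := exists_rectTwistedVacuum (J := β / 2) (Ls := Ls) (fundamentalRep (Fin 2))
    (continuous_fundamentalRep (Fin 2)) fundamentalRep_mem_unitaryGroup (su2PlaquetteTwist S)
  have hΩ : ∀ᵐ a ∂(rectSliceMeasure (Matrix.specialUnitaryGroup (Fin 2) ℂ) Ls), 0 ≤ Ω a := hpos.mono fun a ha => ha.le
  have hlo := su2RectMagneticFluxEnergy_ge hβ Ls S h1 heig
  obtain ⟨hfc, hfb⟩ := su2_plaquetteLoad_continuous_and_bound Ls S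
  have hflat := rectTwisted_abs_vacuum_expectation_sub_haar_le (fundamentalRep (Fin 2)) (Ls := Ls)
    (continuous_fundamentalRep (Fin 2)) fundamentalRep_mem_unitaryGroup (su2PlaquetteTwist S) (β / 2) h1 hΩ heig
    hfc.stronglyMeasurable hfb
  have h2 : |β / 2| * ((2 : ℕ) * (3 * ((Fintype.card (RectTorusSite Ls) : ℝ) * Fintype.card {p : Fin k × Fin k // p.1 < p.2}) +
      Fintype.card (RectTorusSite Ls × Fin k))) =
      |β| * (3 * (Fintype.card (RectTorusSite Ls) * Fintype.card {p : Fin k × Fin k // p.1 < p.2}) +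
        Fintype.card (RectTorusSite Ls × Fin k)) := by
    rw [abs_div, abs_two]; push_cast; ring
  rw [h2] at hflat
  have hflat' := (abs_le.1 hflat).1
  nlinarith [hlo, hflat', hβ]

/-- ★ **THE STRONG-COUPLING LAW OF THE MAGNETIC-FLUX ENERGY**: for `β ≥ 0`,
`|E_mag(β; Ls; S) − β·∫ Σ_{q∈S} Re tr U_q dHaar| ≤ 2β·#S·(e^{4β(3#P+N)} − 1)` (`#P = #sites·k(k−1)/2`, `N = #sites·k`);
on a one-site torus the Haar integral is `#S/2` (`E_mag = (β/2)#S + O(β²)`), for twisted plaquettes with four distinct links it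
is `0`.  Asymptotic statement; finite volume. [cite: tHooft1979Flux] [cite: MontvayMunster1994, §3.2.6] -/
theorem abs_su2RectMagneticFluxEnergy_sub_haar_le {β : ℝ} (hβ : 0 ≤ β) (Ls : Fin k → ℕ) [∀ i, NeZero (Ls i)]
    (S : Finset (RectPlaquette Ls)) :
    |su2RectMagneticFluxEnergy β Ls S -
        β * ∫ a, (∑ q ∈ S, (fundamentalRep (Fin 2) (rectPlaquetteHolonomy a q.1 q.2.1.1 q.2.1.2)).trace.re)
          ∂(rectSliceMeasure (Matrix.specialUnitaryGroup (Fin 2) ℂ) Ls)| ≤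
      β * ((2 * S.card) * (Real.exp (4 * (β * (3 * (Fintype.card (RectTorusSite Ls) * Fintype.card {p : Fin k × Fin k // p.1 < p.2}) +
        Fintype.card (RectTorusSite Ls × Fin k)))) - 1)) := by
  have hup := su2RectMagneticFluxEnergy_sub_haar_le hβ Ls S
  have hlo := su2RectMagneticFluxEnergy_sub_haar_ge hβ Ls S
  rw [abs_of_nonneg hβ] at hup hlo
  set P : ℝ := (Fintype.card (RectTorusSite Ls) : ℝ) * Fintype.card {p : Fin k × Fin k // p.1 < p.2} with hP
  set N : ℝ := (Fintype.card (RectTorusSite Ls × Fin k) : ℝ) with hN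
  -- the upper constant is the smaller one: `e^{4β(P+N)} ≤ e^{4β(3P+N)}`
  have hmono : Real.exp (4 * (β * (P + N))) ≤ Real.exp (4 * (β * (3 * P + N))) := by
    refine Real.exp_le_exp.2 ?_
    have hP0 : 0 ≤ P := by positivity
    nlinarith
  have hS0 : (0 : ℝ) ≤ 2 * S.card := by positivity
  rw [abs_le]
  constructor
  · linarith
  · calc _ ≤ β * ((2 * S.card) * (Real.exp (4 * (β * (P + N))) - 1)) := hup
      _ ≤ β * ((2 * S.card) * (Real.exp (4 * (β * (3 * P + N))) - 1)) := by
          refine mul_le_mul_of_nonneg_left (mul_le_mul_of_nonneg_left ?_ hS0) hβ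
          linarith

end SU2

end Summit.Ventures.YMGap.FlowData
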